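import Summits.BirchSwinnertonDyer.BirchSwinnertonDyer.Theorems.EisensteinPrimesMazurMCOnCellBTwistbackDefectSwapZigzag
import Summits.BirchSwinnertonDyer.BirchSwinnertonDyer.Theorems.EisensteinPrimesMazurMCOnCellBTwistbackTwoStepIsogenyInvariance
import HarnessLib

/-!
# Crux 3 `MazurMCOnCellB` (stmt-BirchSwinnertonDyer-19033), line `twistback` v10 — ZIG-ZAG CLASS DATA: the certified
# two-step edge `TwoStepAt p` descends to `ℚ`-isogeny classes at BOTH ends, zig-zags are equivariant under isogeny, and
# the «connected Ш-unit class» datum of stub 6⁵ is constant on isogeny classes and on zig-zag components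

Width seat bsd-line-x2-p1-w3 (gen 15), cell `bsd-eis`, 2026-08-28; lane F2d (sequel of F2c p671590 `…DefectSwapZigzag`,
whose inline zig-zag relation the LEAD's twistback v10 adopts VERBATIM as the third negated hypothesis of
`stub_upperPartnerOffSubrowNoConnectedClassShaUnit`). `--supports stmt-BirchSwinnertonDyer-19033 --as helper`.
HONEST FRAMING: THEOREMS ONLY (no `def`, no named fact introduced, no `sorry`), conditional on modularity
(`nonempty_modularParametrizationData`, for the conductor of an isogenous curve) where marked and fact-free otherwise;
closes no registered stub; no summit statement, no Mazur main conjecture and no case of BSD is proved for any curve;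
0 cells / labels / stubs / tiers move.

## What

The zig-zag relation of p671590 / twistback v10 (inline, no `def`):
`Z_p A B := TwoStepAt p A B ∨ (TwoStepAt p B A ∧ (B, p) is an X2b pair)`, and its reflexive–transitive closure.

* §1 `exists_twoStepAt_of_isIsogenous_target` — **an edge INTO a curve `B` is shadowed by an edge into any `B′ ∼ B`,
  out of a curve `A′ ∼ A`** (the mirror image of x2-p1-w6 g4's SOURCE-side `exists_twoStepAt_of_isIsogenous`, p672105):
  untwist — a minimal model `Wd′` of `B′^{(d_{K″})}` is isogenous to the intermediate model `Wd` (square twist,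
  `exists_quadraticTwist_quadraticTwist_eq_smul`), a minimal model `A′` of `Wd′^{(d_K)}` is isogenous to `A`, and
  `(A′, Wd′, B′)` is an edge with the SAME fields `K`, `K″` (readings by `analyticRank_eq_of_isIsogenous'`,
  `entireLFunction_eq_of_isIsogenous'`; conductors by `conductorNorm_eq_of_isIsogenous_of_modularity_of_isGloballyMinimal`).
* §2 `exists_zigzag_of_isIsogenous` — **zig-zags are equivariant under a `ℚ`-isogeny of the start curve, up to a
  `ℚ`-isogeny of the far end** (head induction: p672105 §1 at forward steps, §1 at backward steps, the carried X2b
  assertion moved by `X2.cellB_iff_of_isIsogenous` with the Tate uniformisation facts DISCHARGED in the tree);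
  `cellB_of_cellB_of_zigzag` (X2b propagates along zig-zags, `hmod` only) and `zigzag_reverse_of_cellB` (out of an X2b
  pair every zig-zag can be walked back: on the X2b population the component relation is SYMMETRIC).
* §3 the datum of 6⁵ VERBATIM — «`∃ W₁ ∼ W`, a zig-zag `W₁ ⇝ U`, `U ∼ Uc`, `#Ш_an(Uc)` a rational `p`-unit»:
  `exists_connectedClassShaUnit_of_exists_reachableClassShaUnit` (the v9 datum implies the v10 datum),
  `exists_connectedClassShaUnit_of_isIsogenous` / `…_iff_of_isIsogenous` (a CLASS datum, fact-free),
  `exists_connectedClassShaUnit_iff` (the start member `W₁` is redundant, `hmodN`),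
  `exists_connectedClassShaUnit_of_zigzag` (CONSTANT ON ZIG-ZAG COMPONENTS: the excluded population of 6⁵ is a union of
  connected components of the class graph, `hmodN`), and the `not_…` forms matching the stub's negation.

References: x2-p1-w6 g3 p667979, g4 p672105; w3 g14 p669353, p671590; LEAD g14 v10 (HOME STATUS 2026-08-28T22:07Z),
p672690; Cremona, *Algorithms for Modular Elliptic Curves* §3.9 [CremonaAlgorithms1997]; Knapp, *Elliptic Curves* Thm. 11.67
[Knapp1993]; Silverman, *AEC* X.5 Cor. 5.4.1 [SilvermanAEC2009]; Greenberg–Vatsal 2000 Thm. (1.3), §2 [GreenbergVatsal2000].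
-/

set_option autoImplicit false
set_option linter.dupNamespace false -- `Summit.BirchSwinnertonDyer.BirchSwinnertonDyer.…`: summit = sub-problem name

noncomputable section

open scoped Classical

open WeierstrassCurve NumberField
  Literature.NumberTheory.EllipticCurves
  Literature.NumberTheory.EllipticCurves.ModularForms
  Literature.NumberTheory.QuadraticFields
  Literature.NumberTheory.EllipticCurves.Rank1Residual
  Literature.NumberTheory.EllipticCurves.Rank1Residual.Typed
  Summit.BirchSwinnertonDyer.Rank1Residual
  Summit.BirchSwinnertonDyer.BirchSwinnertonDyer.Theorems.EisensteinPrimesMazurMCOnCellBTwistbackTwoStepDefs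
  Summit.BirchSwinnertonDyer.BirchSwinnertonDyer.Theorems.EisensteinPrimesMazurMCOnCellBTwistbackTwoStepIsogenyInvariance
  Summit.BirchSwinnertonDyer.BirchSwinnertonDyer.Theorems.EisensteinPrimesMazurMCOnCellBTwistbackDefectSwapUp
  Summit.BirchSwinnertonDyer.BirchSwinnertonDyer.Theorems.EisensteinPrimesMazurMCOnCellBTwistbackDefectSwapZigzag

namespace Summit.BirchSwinnertonDyer.BirchSwinnertonDyer.Theorems.EisensteinPrimesMazurMCOnCellBTwistbackZigzagClassData

/-! ## §1. One edge, TARGET side: an edge into `B` is shadowed by an edge into any `B′ ∼ B` -/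

/-- **`TwoStepAt p` is equivariant under a `ℚ`-isogeny of the FAR end, up to a `ℚ`-isogeny of the start.** If
`TwoStepAt p A B` (fields `K`, `K″`, intermediate minimal model `Wd` of `A^{(d_K)}`, `B` a minimal model of
`Wd^{(d_{K″})}`) and `B ∼ B′` over `ℚ` with `B′` globally minimal, then some globally minimal `A′ ∼ A` has
`TwoStepAt p A′ B′` with the SAME fields: untwisting, a minimal model `Wd′` of `B′^{(d_{K″})}` is isogenous to
`B^{(d_{K″})} ≅ Wd` (square twist), a minimal model `A′` of `Wd′^{(d_K)}` is isogenous to `Wd^{(d_K)} ≅ A`; and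
`A′^{(d_K)} ≅ Wd′`, `Wd′^{(d_{K″})} ≅ B′` by the square-twist identity again, so the three readings and the two Heegner
hypotheses move along isogenies (Knapp Thm. 11.67; conductor by modularity). `hmodN` only. [cite: CremonaAlgorithms1997, §3.9 (p. 87)] -/
theorem exists_twoStepAt_of_isIsogenous_target (hmodN : nonempty_modularParametrizationData)
    {p : ℕ} {A B B' : WeierstrassCurve ℚ} [B'.IsElliptic] [B'.IsGloballyMinimal]
    (h : TwoStepAt p A B) (hiso : IsIsogenous B B') :
    ∃ (A' : WeierstrassCurve ℚ) (_ : A'.IsElliptic) (_ : A'.IsGloballyMinimal),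
      TwoStepAt p A' B' ∧ IsIsogenous A' A := by
  obtain ⟨_, _, _, _, K, _, _, hK, hHN, hHp, hoddK, hlt, hr1, Wd, _, _, ⟨C, hC⟩, K'', _, _, hK'', hodd'', hlt'',
    hHN'', hHp'', hL'', ⟨C'', hC''⟩⟩ := h
  have hdK : ((NumberField.discr K : ℤ) : ℚ) ≠ 0 := by exact_mod_cast (by omega : NumberField.discr K ≠ 0)
  have hdK'' : ((NumberField.discr K'' : ℤ) : ℚ) ≠ 0 := by exact_mod_cast (by omega : NumberField.discr K'' ≠ 0)
  obtain ⟨C₁, hC₁⟩ := exists_smul_eq_quadraticTwist_symm Wd B hdK'' hC''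
  obtain ⟨C₀, hC₀⟩ := exists_smul_eq_quadraticTwist_symm A Wd hdK hC
  -- a globally minimal model `Wd'` of `B'^{(d_{K″})}`, isogenous to `Wd`
  haveI := B.isElliptic_quadraticTwist hdK''
  haveI := B'.isElliptic_quadraticTwist hdK''
  have hisoB : IsIsogenous (B'.quadraticTwist (NumberField.discr K'' : ℚ))
      (B.quadraticTwist (NumberField.discr K'' : ℚ)) := (hiso.symm_of_charZero).quadraticTwist hdK''
  obtain ⟨Cm, hCm⟩ := hasGlobalMinimalModel_rat_holds (B'.quadraticTwist (NumberField.discr K'' : ℚ))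
  haveI := hCm
  have hisod : IsIsogenous (Cm • B'.quadraticTwist (NumberField.discr K'' : ℚ)) Wd :=
    (isIsogenous_of_smul _ Cm).trans' (hisoB.trans' (isIsogenous_of_smul_eq' hC₁))
  have hNd : (Cm • B'.quadraticTwist (NumberField.discr K'' : ℚ)).conductorNorm ℤ = Wd.conductorNorm ℤ :=
    conductorNorm_eq_of_isIsogenous_of_modularity_of_isGloballyMinimal hmodN hisod
  -- the far end `B'` is a model of `Wd'^{(d_{K″})}` (square twist), so the non-vanishing reading transfers
  obtain ⟨D', hD'⟩ := exists_quadraticTwist_quadraticTwist_eq_smul B' hdK''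
  have hfar : (Cm • B'.quadraticTwist (NumberField.discr K'' : ℚ)).quadraticTwist (NumberField.discr K'' : ℚ) =
      ((⟨Cm.u, (NumberField.discr K'' : ℚ) * Cm.r, 0, 0⟩ : VariableChange ℚ) * D') • B' := by
    rw [quadraticTwist_smul, hD', smul_smul]
  haveI := (Cm • B'.quadraticTwist (NumberField.discr K'' : ℚ)).isElliptic_quadraticTwist hdK''
  haveI := Wd.isElliptic_quadraticTwist hdK''
  have hisoFar : IsIsogenous ((Cm • B'.quadraticTwist (NumberField.discr K'' : ℚ)).quadraticTwist
      (NumberField.discr K'' : ℚ)) (Wd.quadraticTwist (NumberField.discr K'' : ℚ)) :=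
    (isIsogenous_of_smul_eq' hfar.symm).trans' (hiso.symm_of_charZero.trans' (isIsogenous_of_smul_eq hC''))
  have hL' : ((Cm • B'.quadraticTwist (NumberField.discr K'' : ℚ)).quadraticTwist
      (NumberField.discr K'' : ℚ)).entireLFunction 1 ≠ 0 := by
    rw [entireLFunction_eq_of_isIsogenous' hisoFar]; exact hL''
  -- a globally minimal model `A'` of `Wd'^{(d_K)}`, isogenous to `A`
  haveI := (Cm • B'.quadraticTwist (NumberField.discr K'' : ℚ)).isElliptic_quadraticTwist hdK
  haveI := Wd.isElliptic_quadraticTwist hdK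
  have hisoWdK : IsIsogenous ((Cm • B'.quadraticTwist (NumberField.discr K'' : ℚ)).quadraticTwist
      (NumberField.discr K : ℚ)) (Wd.quadraticTwist (NumberField.discr K : ℚ)) := hisod.quadraticTwist hdK
  obtain ⟨Cm', hCm'⟩ := hasGlobalMinimalModel_rat_holds
    ((Cm • B'.quadraticTwist (NumberField.discr K'' : ℚ)).quadraticTwist (NumberField.discr K : ℚ))
  haveI := hCm'
  have hisoA : IsIsogenous
      (Cm' • (Cm • B'.quadraticTwist (NumberField.discr K'' : ℚ)).quadraticTwist (NumberField.discr K : ℚ)) A :=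
    (isIsogenous_of_smul _ Cm').trans' (hisoWdK.trans' (isIsogenous_of_smul_eq' hC₀))
  have hNA : (Cm' • (Cm • B'.quadraticTwist (NumberField.discr K'' : ℚ)).quadraticTwist
      (NumberField.discr K : ℚ)).conductorNorm ℤ = A.conductorNorm ℤ :=
    conductorNorm_eq_of_isIsogenous_of_modularity_of_isGloballyMinimal hmodN hisoA
  -- `Wd'` is a model of `A'^{(d_K)}` (square twist), so the rank-one reading transfers
  obtain ⟨D, hD⟩ := exists_quadraticTwist_quadraticTwist_eq_smul
    (Cm • B'.quadraticTwist (NumberField.discr K'' : ℚ)) hdK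
  have hmid : (Cm' • (Cm • B'.quadraticTwist (NumberField.discr K'' : ℚ)).quadraticTwist
      (NumberField.discr K : ℚ)).quadraticTwist (NumberField.discr K : ℚ) =
      ((⟨Cm'.u, (NumberField.discr K : ℚ) * Cm'.r, 0, 0⟩ : VariableChange ℚ) * D) •
        (Cm • B'.quadraticTwist (NumberField.discr K'' : ℚ)) := by
    rw [quadraticTwist_smul, hD, smul_smul]
  haveI := (Cm' • (Cm • B'.quadraticTwist (NumberField.discr K'' : ℚ)).quadraticTwist
    (NumberField.discr K : ℚ)).isElliptic_quadraticTwist hdK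
  haveI := A.isElliptic_quadraticTwist hdK
  have hisoMid : IsIsogenous ((Cm' • (Cm • B'.quadraticTwist (NumberField.discr K'' : ℚ)).quadraticTwist
      (NumberField.discr K : ℚ)).quadraticTwist (NumberField.discr K : ℚ))
      (A.quadraticTwist (NumberField.discr K : ℚ)) :=
    (isIsogenous_of_smul_eq' hmid.symm).trans' (hisod.trans' (isIsogenous_of_smul_eq hC))
  have hr1' : ((Cm' • (Cm • B'.quadraticTwist (NumberField.discr K'' : ℚ)).quadraticTwist
      (NumberField.discr K : ℚ)).quadraticTwist (NumberField.discr K : ℚ)).analyticRank = 1 := by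
    rw [analyticRank_eq_of_isIsogenous' hisoMid]; exact hr1
  refine ⟨Cm' • (Cm • B'.quadraticTwist (NumberField.discr K'' : ℚ)).quadraticTwist (NumberField.discr K : ℚ),
    inferInstance, hCm', ?_, hisoA⟩
  exact twoStepAt_intro p _ K hK (by rw [hNA]; exact hHN) hHp hoddK hlt hr1'
    (Cm • B'.quadraticTwist (NumberField.discr K'' : ℚ)) ⟨_, hmid.symm⟩ K'' hK'' hodd'' hlt''
    (by rw [hNd]; exact hHN'') hHp'' hL' B' ⟨_, hfar.symm⟩

/-! ## §2. Zig-zags are equivariant under a `ℚ`-isogeny of the start curve; X2b along zig-zags; symmetry on X2b -/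

/-- **Zig-zags of certified two-steps are equivariant under a `ℚ`-isogeny of the start curve, up to a `ℚ`-isogeny of
the far end.** If `W ∼ W₁` (`W` globally minimal) and `W₁ ⇝ U` along the zig-zag relation of twistback v10 (forward
edges `TwoStepAt p A B`; backward edges `TwoStepAt p B A` carrying the X2b assertion of `B`), then some globally minimal
`U₂` has `W ⇝ U₂` and `U₂ ∼ U`: head induction — a forward step is shadowed by p672105 `exists_twoStepAt_of_isIsogenous`,
a backward step by §1 `exists_twoStepAt_of_isIsogenous_target`, and the carried X2b assertion is a class property
(`X2.cellB_iff_of_isIsogenous`, Tate uniformisation discharged: `Silverman1994_thmV53_tateUniformisation_holds`,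
`…corV54…_holds`). Conditional on `hmodN` only. [cite: GreenbergVatsal2000, Thm. (1.3) and §2 p. 28] -/
theorem exists_zigzag_of_isIsogenous (hmodN : nonempty_modularParametrizationData)
    {p : ℕ} [Fact p.Prime] {W W₁ U : WeierstrassCurve ℚ} [W.IsElliptic] [W.IsGloballyMinimal]
    (hiso : IsIsogenous W W₁)
    (h : Relation.ReflTransGen (fun A B : WeierstrassCurve ℚ ↦ TwoStepAt p A B ∨
      (TwoStepAt p B A ∧ ∃ (_ : B.IsElliptic) (_ : B.IsGloballyMinimal), X2.CellB B p)) W₁ U) :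
    ∃ (U₂ : WeierstrassCurve ℚ) (_ : U₂.IsElliptic) (_ : U₂.IsGloballyMinimal),
      Relation.ReflTransGen (fun A B : WeierstrassCurve ℚ ↦ TwoStepAt p A B ∨
        (TwoStepAt p B A ∧ ∃ (_ : B.IsElliptic) (_ : B.IsGloballyMinimal), X2.CellB B p)) W U₂ ∧
      IsIsogenous U₂ U := by
  have key : ∀ {a : WeierstrassCurve ℚ},
      Relation.ReflTransGen (fun A B : WeierstrassCurve ℚ ↦ TwoStepAt p A B ∨
        (TwoStepAt p B A ∧ ∃ (_ : B.IsElliptic) (_ : B.IsGloballyMinimal), X2.CellB B p)) a U →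
      ∀ (V : WeierstrassCurve ℚ) (_ : V.IsElliptic) (_ : V.IsGloballyMinimal), IsIsogenous V a →
        ∃ (U₂ : WeierstrassCurve ℚ) (_ : U₂.IsElliptic) (_ : U₂.IsGloballyMinimal),
          Relation.ReflTransGen (fun A B : WeierstrassCurve ℚ ↦ TwoStepAt p A B ∨
            (TwoStepAt p B A ∧ ∃ (_ : B.IsElliptic) (_ : B.IsGloballyMinimal), X2.CellB B p)) V U₂ ∧
          IsIsogenous U₂ U := by
    intro a ha
    induction ha using Relation.ReflTransGen.head_induction_on with
    | refl =>
      intro V _ _ hV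
      exact ⟨V, inferInstance, inferInstance, Relation.ReflTransGen.refl, hV⟩
    | @head a b hab hbU ih =>
      intro V _ _ hV
      rcases hab with hab | ⟨hba, hEb, hMb, hcb⟩
      · -- forward step `a → b`: shadowed out of `V ∼ a` (source side, p672105)
        obtain ⟨V₂, _, _, hV₂, hiso₂⟩ := exists_twoStepAt_of_isIsogenous hmodN hV hab
        obtain ⟨U₂, _, _, hU₂, hisoU⟩ := ih V₂ inferInstance inferInstance hiso₂
        exact ⟨U₂, inferInstance, inferInstance, Relation.ReflTransGen.head (Or.inl hV₂) hU₂, hisoU⟩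
      · -- backward step `a ← b` with `(b, p)` X2b: shadowed into `V ∼ a` (target side, §1)
        obtain ⟨_, _, _, _, -⟩ := id hba
        obtain ⟨b', _, _, hb', hisob⟩ := exists_twoStepAt_of_isIsogenous_target hmodN hba hV.symm_of_charZero
        have hcb' : X2.CellB b' p :=
          (X2.cellB_iff_of_isIsogenous (p := p) TateCurve.Silverman1994_thmV53_tateUniformisation_holds
            TateCurve.Silverman1994_thmV53_corV54_tateUniformisation_holds hisob).mpr hcb
        obtain ⟨U₂, _, _, hU₂, hisoU⟩ := ih b' inferInstance inferInstance hisob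
        exact ⟨U₂, inferInstance, inferInstance,
          Relation.ReflTransGen.head (Or.inr ⟨hb', inferInstance, inferInstance, hcb'⟩) hU₂, hisoU⟩
  exact key h W inferInstance inferInstance hiso

/-- **X2b propagates along zig-zags** (the light form of p671590's `cellB_and_bsdp_imp_of_cellB_of_zigzag`, modularity
only): a forward step transports X2b by `cellB_of_cellB_of_twoStepAt` (even twist unramified at `p`, Greenberg–Vatsal's
remark after Thm. (1.3)); a backward step carries the X2b assertion of its target.
[cite: GreenbergVatsal2000, remark after Thm. (1.3)] -/
theorem cellB_of_cellB_of_zigzag (hmod : WeierstrassCurve.hasEntireLFunction_rat)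
    {p : ℕ} [Fact p.Prime] {W U : WeierstrassCurve ℚ} [W.IsElliptic] [W.IsGloballyMinimal] (hc : X2.CellB W p)
    (h : Relation.ReflTransGen (fun A B : WeierstrassCurve ℚ ↦ TwoStepAt p A B ∨
      (TwoStepAt p B A ∧ ∃ (_ : B.IsElliptic) (_ : B.IsGloballyMinimal), X2.CellB B p)) W U) :
    ∃ (_ : U.IsElliptic) (_ : U.IsGloballyMinimal), X2.CellB U p := by
  induction h with
  | refl => exact ⟨inferInstance, inferInstance, hc⟩
  | @tail b c _ hbc ih =>
    obtain ⟨_, _, hcb⟩ := ih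
    rcases hbc with hbc | ⟨-, hEc, hMc, hcc⟩
    · obtain ⟨_, _, _, _, -⟩ := id hbc
      exact ⟨inferInstance, inferInstance, cellB_of_cellB_of_twoStepAt hmod hcb hbc⟩
    · exact ⟨hEc, hMc, hcc⟩

/-- **Out of an X2b pair every zig-zag can be walked back**: if `(U, p)` is X2b and `U ⇝ W`, then `W ⇝ U` — a forward
step `a → b` reverses to the backward step `b ← a` carrying the X2b assertion of `a` (propagated from `U` by
`cellB_of_cellB_of_zigzag`), a backward step reverses to a forward step outright. So on the X2b population the zig-zag
relation is SYMMETRIC and «lies in the same component» is an equivalence relation. Modularity only. [folklore] -/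
theorem zigzag_reverse_of_cellB (hmod : WeierstrassCurve.hasEntireLFunction_rat)
    {p : ℕ} [Fact p.Prime] {U W : WeierstrassCurve ℚ} [U.IsElliptic] [U.IsGloballyMinimal] (hcU : X2.CellB U p)
    (h : Relation.ReflTransGen (fun A B : WeierstrassCurve ℚ ↦ TwoStepAt p A B ∨
      (TwoStepAt p B A ∧ ∃ (_ : B.IsElliptic) (_ : B.IsGloballyMinimal), X2.CellB B p)) U W) :
    Relation.ReflTransGen (fun A B : WeierstrassCurve ℚ ↦ TwoStepAt p A B ∨
      (TwoStepAt p B A ∧ ∃ (_ : B.IsElliptic) (_ : B.IsGloballyMinimal), X2.CellB B p)) W U := by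
  induction h with
  | refl => exact Relation.ReflTransGen.refl
  | @tail V W' hUV hVW ih =>
    rcases hVW with hVW | ⟨hWV, -, -, -⟩
    · -- forward `V → W'` reverses to backward `W' ← V` carrying `CellB V`
      obtain ⟨hEV, hMV, hcV⟩ := cellB_of_cellB_of_zigzag hmod hcU hUV
      exact Relation.ReflTransGen.head (Or.inr ⟨hVW, hEV, hMV, hcV⟩) ih
    · -- backward `V ← W'` reverses to forward `W' → V`
      exact Relation.ReflTransGen.head (Or.inl hWV) ih

/-! ## §3. The datum of stub 6⁵ «a Ш-unit class CONNECTED to the class of `W`»: class datum, no `W₁`, constant on components -/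

/-- **The v9 datum implies the v10 datum**: a forward chain `Relation.ReflTransGen (TwoStepAt p)` is a zig-zag
(p671590 `zigzag_of_reflTransGen_twoStepAt`), everything else verbatim. So every per-class «reachable Ш-unit class»
display (x2-p1-w8 g4 `…ReachableCell*`) is a «connected Ш-unit class» display for twistback v10. Fact-free. [folklore] -/
theorem exists_connectedClassShaUnit_of_exists_reachableClassShaUnit {p : ℕ} [Fact p.Prime] {W : WeierstrassCurve ℚ}
    (h : ∃ (W₁ : WeierstrassCurve ℚ) (_ : W₁.IsElliptic) (_ : W₁.IsGloballyMinimal)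
        (W'' : WeierstrassCurve ℚ) (_ : W''.IsElliptic) (_ : W''.IsGloballyMinimal)
        (Wc : WeierstrassCurve ℚ) (_ : Wc.IsElliptic) (_ : Wc.IsGloballyMinimal),
        IsIsogenous W W₁ ∧ Relation.ReflTransGen (TwoStepAt p) W₁ W'' ∧ IsIsogenous W'' Wc ∧
        ∃ q : ℚ, shaAn Wc = (q : ℂ) ∧ padicValRat p q = 0) :
    ∃ (W₁ : WeierstrassCurve ℚ) (_ : W₁.IsElliptic) (_ : W₁.IsGloballyMinimal)
      (W'' : WeierstrassCurve ℚ) (_ : W''.IsElliptic) (_ : W''.IsGloballyMinimal)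
      (Wc : WeierstrassCurve ℚ) (_ : Wc.IsElliptic) (_ : Wc.IsGloballyMinimal),
      IsIsogenous W W₁ ∧
      Relation.ReflTransGen (fun A B : WeierstrassCurve ℚ ↦ TwoStepAt p A B ∨
        (TwoStepAt p B A ∧ ∃ (_ : B.IsElliptic) (_ : B.IsGloballyMinimal), X2.CellB B p)) W₁ W'' ∧
      IsIsogenous W'' Wc ∧ ∃ q : ℚ, shaAn Wc = (q : ℂ) ∧ padicValRat p q = 0 := by
  obtain ⟨W₁, _, _, W'', _, _, Wc, _, _, h₁, hch, hc, hu⟩ := h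
  exact ⟨W₁, inferInstance, inferInstance, W'', inferInstance, inferInstance, Wc, inferInstance, inferInstance, h₁,
    zigzag_of_reflTransGen_twoStepAt hch, hc, hu⟩

/-- **The v10 datum is a union of `ℚ`-isogeny classes** (fact-free, transitivity of `IsIsogenous` at the start):
if `W′ ∼ W` and the datum holds at `W`, it holds at `W′` with the same `W₁`, zig-zag and unit class. [folklore] -/
theorem exists_connectedClassShaUnit_of_isIsogenous {p : ℕ} [Fact p.Prime] {W W' : WeierstrassCurve ℚ}
    (hWW' : IsIsogenous W' W)
    (h : ∃ (W₁ : WeierstrassCurve ℚ) (_ : W₁.IsElliptic) (_ : W₁.IsGloballyMinimal)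
        (W'' : WeierstrassCurve ℚ) (_ : W''.IsElliptic) (_ : W''.IsGloballyMinimal)
        (Wc : WeierstrassCurve ℚ) (_ : Wc.IsElliptic) (_ : Wc.IsGloballyMinimal),
        IsIsogenous W W₁ ∧
        Relation.ReflTransGen (fun A B : WeierstrassCurve ℚ ↦ TwoStepAt p A B ∨
          (TwoStepAt p B A ∧ ∃ (_ : B.IsElliptic) (_ : B.IsGloballyMinimal), X2.CellB B p)) W₁ W'' ∧
        IsIsogenous W'' Wc ∧ ∃ q : ℚ, shaAn Wc = (q : ℂ) ∧ padicValRat p q = 0) :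
    ∃ (W₁ : WeierstrassCurve ℚ) (_ : W₁.IsElliptic) (_ : W₁.IsGloballyMinimal)
      (W'' : WeierstrassCurve ℚ) (_ : W''.IsElliptic) (_ : W''.IsGloballyMinimal)
      (Wc : WeierstrassCurve ℚ) (_ : Wc.IsElliptic) (_ : Wc.IsGloballyMinimal),
      IsIsogenous W' W₁ ∧
      Relation.ReflTransGen (fun A B : WeierstrassCurve ℚ ↦ TwoStepAt p A B ∨
        (TwoStepAt p B A ∧ ∃ (_ : B.IsElliptic) (_ : B.IsGloballyMinimal), X2.CellB B p)) W₁ W'' ∧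
      IsIsogenous W'' Wc ∧ ∃ q : ℚ, shaAn Wc = (q : ℂ) ∧ padicValRat p q = 0 := by
  obtain ⟨W₁, _, _, W'', _, _, Wc, _, _, h₁, hz, hc, hu⟩ := h
  exact ⟨W₁, inferInstance, inferInstance, W'', inferInstance, inferInstance, Wc, inferInstance, inferInstance,
    hWW'.trans' h₁, hz, hc, hu⟩

/-- **The v10 datum is a CLASS datum** (iff form of `exists_connectedClassShaUnit_of_isIsogenous`, both curves elliptic so
that the isogeny reverses). Fact-free. [folklore] -/
theorem exists_connectedClassShaUnit_iff_of_isIsogenous {p : ℕ} [Fact p.Prime] {W W' : WeierstrassCurve ℚ}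
    [W.IsElliptic] [W'.IsElliptic] (hiso : IsIsogenous W W') :
    (∃ (W₁ : WeierstrassCurve ℚ) (_ : W₁.IsElliptic) (_ : W₁.IsGloballyMinimal)
        (W'' : WeierstrassCurve ℚ) (_ : W''.IsElliptic) (_ : W''.IsGloballyMinimal)
        (Wc : WeierstrassCurve ℚ) (_ : Wc.IsElliptic) (_ : Wc.IsGloballyMinimal),
        IsIsogenous W W₁ ∧
        Relation.ReflTransGen (fun A B : WeierstrassCurve ℚ ↦ TwoStepAt p A B ∨
          (TwoStepAt p B A ∧ ∃ (_ : B.IsElliptic) (_ : B.IsGloballyMinimal), X2.CellB B p)) W₁ W'' ∧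
        IsIsogenous W'' Wc ∧ ∃ q : ℚ, shaAn Wc = (q : ℂ) ∧ padicValRat p q = 0) ↔
    (∃ (W₁ : WeierstrassCurve ℚ) (_ : W₁.IsElliptic) (_ : W₁.IsGloballyMinimal)
        (W'' : WeierstrassCurve ℚ) (_ : W''.IsElliptic) (_ : W''.IsGloballyMinimal)
        (Wc : WeierstrassCurve ℚ) (_ : Wc.IsElliptic) (_ : Wc.IsGloballyMinimal),
        IsIsogenous W' W₁ ∧
        Relation.ReflTransGen (fun A B : WeierstrassCurve ℚ ↦ TwoStepAt p A B ∨
          (TwoStepAt p B A ∧ ∃ (_ : B.IsElliptic) (_ : B.IsGloballyMinimal), X2.CellB B p)) W₁ W'' ∧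
        IsIsogenous W'' Wc ∧ ∃ q : ℚ, shaAn Wc = (q : ℂ) ∧ padicValRat p q = 0) :=
  ⟨exists_connectedClassShaUnit_of_isIsogenous hiso.symm_of_charZero, exists_connectedClassShaUnit_of_isIsogenous hiso⟩

/-- **The start member `W₁` of the v10 datum is redundant** (granted modularity, for the conductor): at a globally
minimal elliptic `W` the datum holds iff «`∃ U Uc`, `W ⇝ U` along zig-zags, `U ∼ Uc`, `#Ш_an(Uc)` a rational `p`-unit»
(`→`: §2 and transitivity at the far end; `←`: `W₁ := W`). The left side is VERBATIM the negated third hypothesis of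
`stub_upperPartnerOffSubrowNoConnectedClassShaUnit` (twistback v10). Conditional on `hmodN` only. [folklore] -/
theorem exists_connectedClassShaUnit_iff (hmodN : nonempty_modularParametrizationData)
    {p : ℕ} [Fact p.Prime] (W : WeierstrassCurve ℚ) [W.IsElliptic] [W.IsGloballyMinimal] :
    (∃ (W₁ : WeierstrassCurve ℚ) (_ : W₁.IsElliptic) (_ : W₁.IsGloballyMinimal)
        (W'' : WeierstrassCurve ℚ) (_ : W''.IsElliptic) (_ : W''.IsGloballyMinimal)
        (Wc : WeierstrassCurve ℚ) (_ : Wc.IsElliptic) (_ : Wc.IsGloballyMinimal),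
        IsIsogenous W W₁ ∧
        Relation.ReflTransGen (fun A B : WeierstrassCurve ℚ ↦ TwoStepAt p A B ∨
          (TwoStepAt p B A ∧ ∃ (_ : B.IsElliptic) (_ : B.IsGloballyMinimal), X2.CellB B p)) W₁ W'' ∧
        IsIsogenous W'' Wc ∧ ∃ q : ℚ, shaAn Wc = (q : ℂ) ∧ padicValRat p q = 0) ↔
    (∃ (W'' : WeierstrassCurve ℚ) (_ : W''.IsElliptic) (_ : W''.IsGloballyMinimal)
        (Wc : WeierstrassCurve ℚ) (_ : Wc.IsElliptic) (_ : Wc.IsGloballyMinimal),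
        Relation.ReflTransGen (fun A B : WeierstrassCurve ℚ ↦ TwoStepAt p A B ∨
          (TwoStepAt p B A ∧ ∃ (_ : B.IsElliptic) (_ : B.IsGloballyMinimal), X2.CellB B p)) W W'' ∧
        IsIsogenous W'' Wc ∧ ∃ q : ℚ, shaAn Wc = (q : ℂ) ∧ padicValRat p q = 0) := by
  constructor
  · rintro ⟨W₁, _, _, W'', _, _, Wc, _, _, h₁, hz, hc, hu⟩
    obtain ⟨U₂, _, _, hU₂, hiso₂⟩ := exists_zigzag_of_isIsogenous hmodN h₁ hz
    exact ⟨U₂, inferInstance, inferInstance, Wc, inferInstance, inferInstance, hU₂, hiso₂.trans' hc, hu⟩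
  · rintro ⟨W'', _, _, Wc, _, _, hz, hc, hu⟩
    exact ⟨W, inferInstance, inferInstance, W'', inferInstance, inferInstance, Wc, inferInstance, inferInstance,
      isIsogenous_self W, hz, hc, hu⟩

/-- **The negations agree** (`not_congr` of `exists_connectedClassShaUnit_iff`): the v10 stub's third hypothesis may be
read with or without the start member `W₁`. Conditional on `hmodN` only. [folklore] -/
theorem not_exists_connectedClassShaUnit_iff (hmodN : nonempty_modularParametrizationData)
    {p : ℕ} [Fact p.Prime] (W : WeierstrassCurve ℚ) [W.IsElliptic] [W.IsGloballyMinimal] :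
    (¬ ∃ (W₁ : WeierstrassCurve ℚ) (_ : W₁.IsElliptic) (_ : W₁.IsGloballyMinimal)
        (W'' : WeierstrassCurve ℚ) (_ : W''.IsElliptic) (_ : W''.IsGloballyMinimal)
        (Wc : WeierstrassCurve ℚ) (_ : Wc.IsElliptic) (_ : Wc.IsGloballyMinimal),
        IsIsogenous W W₁ ∧
        Relation.ReflTransGen (fun A B : WeierstrassCurve ℚ ↦ TwoStepAt p A B ∨
          (TwoStepAt p B A ∧ ∃ (_ : B.IsElliptic) (_ : B.IsGloballyMinimal), X2.CellB B p)) W₁ W'' ∧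
        IsIsogenous W'' Wc ∧ ∃ q : ℚ, shaAn Wc = (q : ℂ) ∧ padicValRat p q = 0) ↔
    (¬ ∃ (W'' : WeierstrassCurve ℚ) (_ : W''.IsElliptic) (_ : W''.IsGloballyMinimal)
        (Wc : WeierstrassCurve ℚ) (_ : Wc.IsElliptic) (_ : Wc.IsGloballyMinimal),
        Relation.ReflTransGen (fun A B : WeierstrassCurve ℚ ↦ TwoStepAt p A B ∨
          (TwoStepAt p B A ∧ ∃ (_ : B.IsElliptic) (_ : B.IsGloballyMinimal), X2.CellB B p)) W W'' ∧
        IsIsogenous W'' Wc ∧ ∃ q : ℚ, shaAn Wc = (q : ℂ) ∧ padicValRat p q = 0) :=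
  not_congr (exists_connectedClassShaUnit_iff hmodN W)

/-- **The v10 datum is CONSTANT ON ZIG-ZAG COMPONENTS**: if `W ⇝ U` along zig-zags (`W`, `U` globally minimal) and the
datum holds at `U` (some `U₁ ∼ U` is connected to a Ш-unit class), then it holds at `W` — push the isogeny `U ∼ U₁`
through `U₁`'s zig-zag (§2), concatenate (`Relation.ReflTransGen.trans`), take `W₁ := W`. So the population EXCLUDED by
stub 6⁵ is a union of connected components of the class graph; together with `zigzag_reverse_of_cellB` an X2b pair is
excluded iff any X2b pair in its component is. Conditional on `hmodN` only. [folklore] -/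
theorem exists_connectedClassShaUnit_of_zigzag (hmodN : nonempty_modularParametrizationData)
    {p : ℕ} [Fact p.Prime] {W : WeierstrassCurve ℚ} [W.IsElliptic] [W.IsGloballyMinimal]
    (U : WeierstrassCurve ℚ) [U.IsElliptic] [U.IsGloballyMinimal]
    (hz : Relation.ReflTransGen (fun A B : WeierstrassCurve ℚ ↦ TwoStepAt p A B ∨
      (TwoStepAt p B A ∧ ∃ (_ : B.IsElliptic) (_ : B.IsGloballyMinimal), X2.CellB B p)) W U)
    (hU : ∃ (U₁ : WeierstrassCurve ℚ) (_ : U₁.IsElliptic) (_ : U₁.IsGloballyMinimal)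
        (U'' : WeierstrassCurve ℚ) (_ : U''.IsElliptic) (_ : U''.IsGloballyMinimal)
        (Uc : WeierstrassCurve ℚ) (_ : Uc.IsElliptic) (_ : Uc.IsGloballyMinimal),
        IsIsogenous U U₁ ∧
        Relation.ReflTransGen (fun A B : WeierstrassCurve ℚ ↦ TwoStepAt p A B ∨
          (TwoStepAt p B A ∧ ∃ (_ : B.IsElliptic) (_ : B.IsGloballyMinimal), X2.CellB B p)) U₁ U'' ∧
        IsIsogenous U'' Uc ∧ ∃ q : ℚ, shaAn Uc = (q : ℂ) ∧ padicValRat p q = 0) :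
    ∃ (W₁ : WeierstrassCurve ℚ) (_ : W₁.IsElliptic) (_ : W₁.IsGloballyMinimal)
      (W'' : WeierstrassCurve ℚ) (_ : W''.IsElliptic) (_ : W''.IsGloballyMinimal)
      (Wc : WeierstrassCurve ℚ) (_ : Wc.IsElliptic) (_ : Wc.IsGloballyMinimal),
      IsIsogenous W W₁ ∧
      Relation.ReflTransGen (fun A B : WeierstrassCurve ℚ ↦ TwoStepAt p A B ∨
        (TwoStepAt p B A ∧ ∃ (_ : B.IsElliptic) (_ : B.IsGloballyMinimal), X2.CellB B p)) W₁ W'' ∧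
      IsIsogenous W'' Wc ∧ ∃ q : ℚ, shaAn Wc = (q : ℂ) ∧ padicValRat p q = 0 := by
  obtain ⟨U₁, _, _, U'', _, _, Uc, _, _, h₁, hzU, hc, hu⟩ := hU
  obtain ⟨U₂, _, _, hU₂, hiso₂⟩ := exists_zigzag_of_isIsogenous hmodN h₁ hzU
  exact ⟨W, inferInstance, inferInstance, U₂, inferInstance, inferInstance, Uc, inferInstance, inferInstance,
    isIsogenous_self W, hz.trans hU₂, hiso₂.trans' hc, hu⟩

/-- **Contrapositive, in the stub's polarity**: if NO Ш-unit class is connected to the class of `W` (the third hypothesis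
of `stub_upperPartnerOffSubrowNoConnectedClassShaUnit` at `W`), then the same holds at every globally minimal `U` with
`W ⇝ U`. Conditional on `hmodN` only. [folklore] -/
theorem not_exists_connectedClassShaUnit_of_zigzag (hmodN : nonempty_modularParametrizationData)
    {p : ℕ} [Fact p.Prime] {W : WeierstrassCurve ℚ} [W.IsElliptic] [W.IsGloballyMinimal]
    (U : WeierstrassCurve ℚ) [U.IsElliptic] [U.IsGloballyMinimal]
    (hz : Relation.ReflTransGen (fun A B : WeierstrassCurve ℚ ↦ TwoStepAt p A B ∨
      (TwoStepAt p B A ∧ ∃ (_ : B.IsElliptic) (_ : B.IsGloballyMinimal), X2.CellB B p)) W U)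
    (hW : ¬ ∃ (W₁ : WeierstrassCurve ℚ) (_ : W₁.IsElliptic) (_ : W₁.IsGloballyMinimal)
        (W'' : WeierstrassCurve ℚ) (_ : W''.IsElliptic) (_ : W''.IsGloballyMinimal)
        (Wc : WeierstrassCurve ℚ) (_ : Wc.IsElliptic) (_ : Wc.IsGloballyMinimal),
        IsIsogenous W W₁ ∧
        Relation.ReflTransGen (fun A B : WeierstrassCurve ℚ ↦ TwoStepAt p A B ∨
          (TwoStepAt p B A ∧ ∃ (_ : B.IsElliptic) (_ : B.IsGloballyMinimal), X2.CellB B p)) W₁ W'' ∧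
        IsIsogenous W'' Wc ∧ ∃ q : ℚ, shaAn Wc = (q : ℂ) ∧ padicValRat p q = 0) :
    ¬ ∃ (U₁ : WeierstrassCurve ℚ) (_ : U₁.IsElliptic) (_ : U₁.IsGloballyMinimal)
        (U'' : WeierstrassCurve ℚ) (_ : U''.IsElliptic) (_ : U''.IsGloballyMinimal)
        (Uc : WeierstrassCurve ℚ) (_ : Uc.IsElliptic) (_ : Uc.IsGloballyMinimal),
        IsIsogenous U U₁ ∧
        Relation.ReflTransGen (fun A B : WeierstrassCurve ℚ ↦ TwoStepAt p A B ∨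
          (TwoStepAt p B A ∧ ∃ (_ : B.IsElliptic) (_ : B.IsGloballyMinimal), X2.CellB B p)) U₁ U'' ∧
        IsIsogenous U'' Uc ∧ ∃ q : ℚ, shaAn Uc = (q : ℂ) ∧ padicValRat p q = 0 :=
  fun hU ↦ hW (exists_connectedClassShaUnit_of_zigzag hmodN U hz hU)

end Summit.BirchSwinnertonDyer.BirchSwinnertonDyer.Theorems.EisensteinPrimesMazurMCOnCellBTwistbackZigzagClassData

end
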